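import Mathlib.RingTheory.Norm.Transitivity
import Mathlib.FieldTheory.Fixed
import Literature.NumberTheory.GaloisRepresentations.SuperellipticLambdaTorsionCoprime
import Literature.NumberTheory.GaloisRepresentations.PicardLambdaAdicRepDivisible
import Literature.FieldTheory.QuasiAlgClosed.NormSurjective
import Literature.FieldTheory.QuasiAlgClosed.Tsen
import HarnessLib

/-!
# `Pic⁰(C_f)` is `(1 - δ)`-divisible for `C_f : y^p = f(x)` over an algebraically closed field (via Tsen);
# for Picard curves `#J_f[3ⁿ] = 3^{6n}` and `T₃ J_f ≅ ℤ₃⁶ ≅ ℤ₃[ω]³`, unconditionally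

Topic `Literature/NumberTheory/GaloisRepresentations` (continues `SuperellipticLambdaTorsionCoprime`,
`PicardTateModuleEisenstein`, `PicardLambdaAdicRepDivisible`).  Let `L` be algebraically closed, `p` a prime with
`ζ_p ∈ L` (`p ≠ char L`), `f ∈ K[X]` separable with `p ∤ deg f`, `L(C_f) = L(x)[y]/(y^p - f)` the function field
of `C_f : y^p = f(x)` (`SuperellipticFunctionField`), `δ : y ↦ ζ₀ y` the deck transformation of a primitive `p`-th
root of unity `ζ₀` (`CyclicCoverDeck.ofRoot`), acting on places, divisors and on `Pic(C_{f,L}) = Cl(L(C_f)/L)`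
(`SuperellipticPic`), and `N = 1 + δ + ⋯ + δ^{p-1}` the norm of the cyclic group `G = ⟨δ⟩ ≅ ℤ/p`.

## Main results (all proved; no named facts)

* `SuperellipticFunctionField.isGalois_ratFunc`, `natCard_algEquiv_eq` — `L(C_f)/L(x)` is Galois with exactly
  the `p` deck transformations as automorphisms; `algebraMap_norm_eq_prod_deck_pow_smul` —
  `N_{L(C_f)/L(x)}(z) = ∏_{i<p} δ^i z` (Mathlib `Algebra.norm_eq_prod_automorphisms`).
* `exists_prod_deck_pow_smul_eq_algebraMap` — **every `r ∈ L(x)` is a norm** `∏ δ^i ψ` from `L(C_f)`: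
  TSEN'S THEOREM (`L(x)` is `(C₁)`, `Literature.FieldTheory.QuasiAlgClosed.isCr_one_ratFunc`) and the surjectivity of
  norms from finite extensions of `(C₁)` fields (`IsCr.norm_surjective_one`; Shatz IV §3 Thm. 24, Prop. 33 (2)).
* `exists_sum_deck_pow_smul_eq_principalDivisor` — for `deg D = 0`, `N(D) = (r)` with `r ∈ L(x)^×` (norm relation
  `sum_deck_pow_smul_sub_mem` of `SuperellipticLambdaTorsionCoprime`; a function with deck-invariant divisor is
  `r(x) y^j`, and `j = 0` by the coefficient `p · D(T_α) = p · v_α(r) + j` at a ramification place).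
* `exists_eq_sub_deck_smul_of_sum_deck_pow_smul_eq_zero` — **`ker N = (1 - δ) Div`**: a divisor with `N(E) = 0` is
  `E₂ - δ E₂` (`Ĥ⁻¹(G, Div) = 0`: deck-fixed places carry coefficient `p · E(Q)` in `N(E)`, free orbits telescope,
  `orbitSum_sub_deck_smul_orbitSum`; induction on the support).
* `exists_sub_deck_smul_eq_of_degree_eq_zero` — **`Pic⁰(C_{f,L}) = (1 - δ) Pic⁰(C_{f,L})`**: every degree-zero
  class is `c' - δ c'` with `deg c' = 0`.  This is the vanishing of `Ĥ⁻¹(G, Pic⁰) = Pic⁰/(1 - δ)Pic⁰` (as `N = 0` on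
  `Pic⁰`), obtained from the two exact sequences `0 → L^× → L(C_f)^× → Princ → 0`, `0 → Princ → Div⁰ → Pic⁰ → 0` of
  `ℤ[G]`-modules exactly as in Schaefer 1998, proof of Prop. 3.2 (there for `H¹`), the input being
  `Ĥ⁰(G, L(C_f)^×) = L(x)^×/N L(C_f)^× = 0` (Tsen) in place of Hilbert 90.  Geometrically: "`1 - ζ : J → J` is an
  isogeny, hence surjective on `L`-points" (Mumford §6 Appl. 2) — proved here in the function field, without the Jacobian.
* `geomPic_exists_lamAddMonoidHom_eq`, **`geomPic_exists_three_smul_eq_of_degree_eq_zero`** (`p = 3`, over `K̄` for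
  `K ∋ ζ₃`): `Pic⁰(C_{f,K̄})` is `λ`-divisible and **`3`-divisible** (`3 = -ω²λ²` in `ℤ[δ] = ℤ[ω]`,
  `lamAddMonoidHom_lamAddMonoidHom_of_degree_eq_zero`) — the hypothesis `hdiv` / `hX1'` (Rosen Thm. 11.12 (i) for
  `K̄(C_f)`, `N = 3`) of `PicardLambdaAdicRepDivisible`, now a theorem.
* `geomPic_eq_zero_of_three_pow_smul_eq_zero` — an injectivity criterion for deck-compatible homomorphisms out of
  `Pic(C_{f,K̄})` (e.g. reduction maps): injective on `J[λ]` ⇒ injective on all `3`-power torsion (formal; the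
  torsion clause of the Serre–Tate good-reduction datum for `ℓ = 3`).
* **`picard_card_torsionBy_three_pow`** — for the Picard curve `y³ = f(x)`, `f ∈ ℤ[X]` a quartic separable over `ℚ`,
  `K ⊇ ℚ(ω)`: `#J_f[3ⁿ] = 3^{6n}` for all `n` (`= ℓ^{2gn}`, `g = 3`), UNCONDITIONALLY (`picard_hcard_of_divisible`);
  **`picard_nonempty_tateModule_linearEquiv`** — `T₃ J(C_f) ≅ ℤ₃⁶`; **`picard_nonempty_tateModule_linearEquiv_padicEisenstein`**
  — `T₃ J(C_f) ≅ ℤ₃[ω]³` over `ℤ₃[ω]` (`ω ↦ δ`; `picard_nonempty_basis_tateModule`), both unconditional.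

Consequently the torsion-count hypothesis `hcardK` of
`picardCurve_exists_lambdaAdicRep_of_card_goodReduction_lefschetz` and the divisibility hypothesis `hX1'` of
`picardCurve_exists_lambdaAdicRep_of_divisible_goodReduction_lefschetz` (`PicardLambdaAdicRepDivisible`) are
discharged by `picard_card_torsionBy_three_pow` / `geomPic_exists_three_smul_eq_of_degree_eq_zero`: toward the named
fact `picardCurve_exists_lambdaAdicRep` (Upton 2009) only the good-reduction datum (`hX2`, Serre–Tate) and the
trace formula on the special fibre (`hX3` / `hW`, Weil) remain as inputs (cf. `picardCurve_exists_lambdaAdicRep_of_goodReduction_lefschetz`,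
`…_of_goodReduction_weil`, which reach the same conclusion through Hasse–Weil instead).

## References

* E. F. Schaefer, *Computing a Selmer group of a Jacobian using functions on the curve*, Math. Ann. 310 (1998)
  447–471 = arXiv:1507.08325, §3, proof of Prop. 3.2 (the `G`-cohomology of `0 → K̄^* → K̄(C)^* → Princ → 0` and
  `0 → Princ → Div⁰ → J → 0`; "`H²(G, K̄^*) ≅ ker(1-τ)/image(Norm)`, where `Norm = 1 + … + τ^{p-1}`"). [Schaefer1998]
* S. S. Shatz, *Profinite groups, arithmetic, and geometry* (1972), Ch. IV §3 Thm. 24 (Tsen) and Prop. 33 (2)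
  (norms from finite extensions of a QAC field are surjective). [Shatz1972]
* J.-P. Serre, *Cohomologie galoisienne*, II §3.2 Prop. 8 (b), §3.3 (b). [SerreGaloisCohomology1997]
* D. Mumford, *Abelian Varieties* (1970), §6, Application 2 (an isogeny is surjective on points over an
  algebraically closed field; the points of an abelian variety form a divisible group). [MumfordAV1970]
* M. Rosen, *Number Theory in Function Fields*, GTM 210 (2002), Ch. 11, Thm. 11.12 and its Corollary
  (`Cl⁰` over an algebraically closed constant field is divisible; `Cl⁰[ℓⁿ] ≅ (ℤ/ℓⁿ)^{2g}`). [RosenFunctionFields2002]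
* C. Upton, *Galois representations attached to Picard curves*, J. Algebra 322 (2009), §2. [Upton2009]
* J.-P. Serre, *Abelian ℓ-adic representations and elliptic curves* (1968), Ch. I §1.1. [SerreAbelianLadic1968]
* H. Stichtenoth, *Algebraic Function Fields and Codes*, GTM 254 (2009), Thm. 3.7.1, Prop. 3.7.3. [Stichtenoth2009]

## Design notes

* Everything is proved for an arbitrary prime `p`, an arbitrary algebraically closed `L ⊇ K` and the deck
  transformation `CyclicCoverDeck.ofRoot hζ₀.pow_eq_one` of a primitive root `ζ₀ ∈ L`, in the vocabulary of
  `SuperellipticTorsionRepProofs` / `SuperellipticLambdaTorsionCoprime`; the `p = 3` statements are then read off for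
  `GeomPic K 3 f` (`deckGen hζ` is this deck transformation for `ζ₀ = ζ ∈ K`) and for the Picard curve.
* The local instances `Finsupp.comapSMul` / `comapMulAction` / `comapDistribMulAction` (the action on divisors by
  transport of places) are those of `DivisorClassGaloisAction` and of all the superelliptic files.
* What is NOT here: `p`-divisibility for general `p` (needs `(1 - δ)^{p-1} ∼ p` in `ℤ[ζ_p]`, only `p = 3` is in the
  tree), divisibility by primes `ℓ ≠ p` (genuinely needs the Jacobian / Weil), and anything about the reduction map or
  the trace formula (`hX2`, `hX3`).
-/

noncomputable section

open Polynomial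
open scoped Classical

namespace Literature.NumberTheory.GaloisRepresentations

open Literature.NumberTheory.DiophantineGeometry Literature.NumberTheory.DiophantineGeometry.AlgFunctionField

universe u v w

attribute [local instance] Finsupp.comapSMul Finsupp.comapMulAction Finsupp.comapDistribMulAction

namespace SuperellipticFunctionField

variable {K : Type u} [Field K] {L : Type v} [Field L] [Algebra K L] {p : ℕ} {f : K[X]}
variable [Fact (Irreducible (superellipticPoly K L p f))]

/-! ### `L(C_f)/L(x)` is Galois with group the deck group; the norm is the product of the deck conjugates -/

/-- `L(C_f)` is finite-dimensional over `L(x)` (power basis `1, y, …, y^{p-1}`). [folklore] -/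
theorem finiteDimensional_ratFunc :
    FiniteDimensional (RatFunc L) (SuperellipticFunctionField K L p f) :=
  (AdjoinRoot.powerBasis (Fact.out : Irreducible (superellipticPoly K L p f)).ne_zero).finite

variable [hp : Fact p.Prime]

/-- The deck transformations `δ^i`, `i < p`, attached to a primitive `p`-th root of unity are pairwise
distinct already on `y` (`δ^i y = ζ₀^i y`). [folklore] -/
theorem deck_pow_injective {ζ₀ : L} (hζ₀ : IsPrimitiveRoot ζ₀ p) (hf : f ≠ 0) {i j : ℕ} (hi : i < p) (hj : j < p)
    (h : (CyclicCoverDeck.ofRoot hζ₀.pow_eq_one ^ i) • genY K L p f =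
      (CyclicCoverDeck.ofRoot hζ₀.pow_eq_one ^ j) • genY K L p f) : i = j := by
  haveI : NeZero p := ⟨hp.out.ne_zero⟩
  rw [deck_smul_genY, deck_smul_genY, CyclicCoverDeck.val_pow_eq_pow_val, CyclicCoverDeck.val_pow_eq_pow_val,
    CyclicCoverDeck.val_ofRoot] at h
  have hy0 := genY_ne_zero (K := K) (L := L) hp.out.ne_zero hf
  exact hζ₀.pow_inj hi hj ((algebraMap L _).injective (mul_right_cancel₀ hy0 h))

/-- **`#Aut(L(C_f)/L(x)) = p`**: the `p` deck transformations are `L(x)`-automorphisms, and there are at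
most `[L(C_f) : L(x)] = p` automorphisms (Mathlib `AlgEquiv.card_le`). [cite: Stichtenoth2009, Thm. 3.7.1] -/
theorem natCard_algEquiv_eq {ζ₀ : L} (hζ₀ : IsPrimitiveRoot ζ₀ p) (hf : f ≠ 0) :
    Nat.card (SuperellipticFunctionField K L p f ≃ₐ[RatFunc L] SuperellipticFunctionField K L p f) = p := by
  haveI : NeZero p := ⟨hp.out.ne_zero⟩
  haveI := finiteDimensional_ratFunc (K := K) (L := L) (p := p) (f := f)
  haveI : SMulCommClass (CyclicCoverDeck L p) (RatFunc L) (SuperellipticFunctionField K L p f) :=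
    ⟨deck_smul_smul⟩
  set δ := CyclicCoverDeck.ofRoot hζ₀.pow_eq_one with hδ
  let τ : Fin p → (SuperellipticFunctionField K L p f ≃ₐ[RatFunc L] SuperellipticFunctionField K L p f) :=
    fun i => MulSemiringAction.toAlgEquiv (RatFunc L) (SuperellipticFunctionField K L p f) (δ ^ (i : ℕ))
  have hτ : Function.Injective τ := by
    intro i j hij
    have h := AlgEquiv.congr_fun hij (genY K L p f)
    simp only [τ, MulSemiringAction.toAlgEquiv_apply] at h
    exact Fin.ext (deck_pow_injective hζ₀ hf i.2 j.2 h)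
  rw [Nat.card_eq_fintype_card]
  refine le_antisymm ?_ ?_
  · exact (AlgEquiv.card_le (F := RatFunc L) (K := SuperellipticFunctionField K L p f)).trans_eq
      (finrank_eq K L p f)
  · simpa using Fintype.card_le_of_injective τ hτ

/-- **`L(C_f)/L(x)` is Galois** (`#Aut = [L(C_f) : L(x)]`). [cite: Stichtenoth2009, Thm. 3.7.1] -/
theorem isGalois_ratFunc {ζ₀ : L} (hζ₀ : IsPrimitiveRoot ζ₀ p) (hf : f ≠ 0) :
    IsGalois (RatFunc L) (SuperellipticFunctionField K L p f) := by
  haveI := finiteDimensional_ratFunc (K := K) (L := L) (p := p) (f := f)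
  exact IsGalois.of_card_aut_eq_finrank _ _ ((natCard_algEquiv_eq hζ₀ hf).trans (finrank_eq K L p f).symm)

/-- **The norm is the product of the deck conjugates**: `N_{L(C_f)/L(x)}(z) = ∏_{i<p} δ^i z` in `L(C_f)`
(Mathlib `Algebra.norm_eq_prod_automorphisms` for the Galois extension `L(C_f)/L(x)`, whose automorphisms
are exactly the `p` deck transformations). [folklore] -/
theorem algebraMap_norm_eq_prod_deck_pow_smul {ζ₀ : L} (hζ₀ : IsPrimitiveRoot ζ₀ p) (hf : f ≠ 0)
    (z : SuperellipticFunctionField K L p f) :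
    algebraMap (RatFunc L) (SuperellipticFunctionField K L p f) (Algebra.norm (RatFunc L) z) =
      ∏ i ∈ Finset.range p, (CyclicCoverDeck.ofRoot hζ₀.pow_eq_one ^ i) • z := by
  haveI : NeZero p := ⟨hp.out.ne_zero⟩
  haveI := finiteDimensional_ratFunc (K := K) (L := L) (p := p) (f := f)
  haveI := isGalois_ratFunc (K := K) (L := L) (p := p) (f := f) hζ₀ hf
  haveI : SMulCommClass (CyclicCoverDeck L p) (RatFunc L) (SuperellipticFunctionField K L p f) :=
    ⟨deck_smul_smul⟩
  set δ := CyclicCoverDeck.ofRoot hζ₀.pow_eq_one with hδ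
  let τ : Fin p → (SuperellipticFunctionField K L p f ≃ₐ[RatFunc L] SuperellipticFunctionField K L p f) :=
    fun i => MulSemiringAction.toAlgEquiv (RatFunc L) (SuperellipticFunctionField K L p f) (δ ^ (i : ℕ))
  have hτ : Function.Injective τ := by
    intro i j hij
    have h := AlgEquiv.congr_fun hij (genY K L p f)
    simp only [τ, MulSemiringAction.toAlgEquiv_apply] at h
    exact Fin.ext (deck_pow_injective hζ₀ hf i.2 j.2 h)
  have hbij : Function.Bijective τ := by
    rw [Fintype.bijective_iff_injective_and_card]
    refine ⟨hτ, ?_⟩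
    rw [Fintype.card_fin, ← Nat.card_eq_fintype_card, natCard_algEquiv_eq hζ₀ hf]
  rw [Algebra.norm_eq_prod_automorphisms, ← Fin.prod_univ_eq_prod_range]
  exact (Fintype.prod_bijective τ hbij (fun i => (δ ^ (i : ℕ)) • z) (fun σ => σ z) fun i => rfl).symm

/-- **Every rational function is a norm from `L(C_f)`** for `L` algebraically closed — Tsen's theorem
(`L(x)` is `(C₁)`, `isCr_one_ratFunc`) and the surjectivity of norms from finite extensions of `(C₁)` fields
(`IsCr.norm_surjective_one`); in the form `∏_{i<p} δ^i ψ = r`. [cite: Shatz1972, Ch. IV §3 Thm. 24 and Prop. 33 (2)]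
[cite: SerreGaloisCohomology1997, II §3.2 Prop. 8 (b) and §3.3 (b)] -/
theorem exists_prod_deck_pow_smul_eq_algebraMap [IsAlgClosed L] {ζ₀ : L} (hζ₀ : IsPrimitiveRoot ζ₀ p) (hf : f ≠ 0)
    (r : RatFunc L) :
    ∃ ψ : SuperellipticFunctionField K L p f,
      ∏ i ∈ Finset.range p, (CyclicCoverDeck.ofRoot hζ₀.pow_eq_one ^ i) • ψ =
        algebraMap (RatFunc L) (SuperellipticFunctionField K L p f) r := by
  haveI := finiteDimensional_ratFunc (K := K) (L := L) (p := p) (f := f)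
  obtain ⟨ψ, hψ⟩ := (Literature.FieldTheory.QuasiAlgClosed.isCr_one_ratFunc (k := L)).norm_surjective_one
    (L := SuperellipticFunctionField K L p f) r
  exact ⟨ψ, by rw [← algebraMap_norm_eq_prod_deck_pow_smul hζ₀ hf, hψ]⟩

/-! ### The norm `N = 1 + δ + ⋯ + δ^{p-1}` on divisors -/

omit [Fact (Irreducible (superellipticPoly K L p f))] hp in
/-- Cyclic reindexing: `δ ∑_{i<p} δ^i x = ∑_{i<p} δ^i x` (`δ^p = 1`). [folklore] -/
theorem deck_smul_sum_deck_pow_smul [NeZero p] {β : Type*} [AddCommGroup β] [DistribMulAction (CyclicCoverDeck L p) β]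
    {ζ₀ : L} (hζ₀ : IsPrimitiveRoot ζ₀ p) (x : β) :
    CyclicCoverDeck.ofRoot hζ₀.pow_eq_one • ∑ i ∈ Finset.range p, (CyclicCoverDeck.ofRoot hζ₀.pow_eq_one ^ i) • x =
      ∑ i ∈ Finset.range p, (CyclicCoverDeck.ofRoot hζ₀.pow_eq_one ^ i) • x := by
  set δ := CyclicCoverDeck.ofRoot hζ₀.pow_eq_one with hδ
  have hδp : δ ^ p = 1 := CyclicCoverDeck.ofRoot_pow_eq_one hζ₀.pow_eq_one
  rw [Finset.smul_sum]
  simp only [← mul_smul, ← pow_succ']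
  have h1 := Finset.sum_range_succ' (fun k => (δ ^ k) • x) p
  have h2 := Finset.sum_range_succ (fun k => (δ ^ k) • x) p
  rw [hδp, pow_zero] at *
  rw [h2] at h1
  exact (add_right_cancel h1).symm

omit [Fact (Irreducible (superellipticPoly K L p f))] hp in
/-- `∑_{i<p} δ^i (δ x) = ∑_{i<p} δ^i x`. [folklore] -/
theorem sum_deck_pow_smul_deck_smul [NeZero p] {β : Type*} [AddCommGroup β] [DistribMulAction (CyclicCoverDeck L p) β]
    {ζ₀ : L} (hζ₀ : IsPrimitiveRoot ζ₀ p) (x : β) :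
    ∑ i ∈ Finset.range p, (CyclicCoverDeck.ofRoot hζ₀.pow_eq_one ^ i) • (CyclicCoverDeck.ofRoot hζ₀.pow_eq_one • x) =
      ∑ i ∈ Finset.range p, (CyclicCoverDeck.ofRoot hζ₀.pow_eq_one ^ i) • x := by
  rw [← deck_smul_sum_deck_pow_smul hζ₀ x, Finset.smul_sum]
  refine Finset.sum_congr rfl fun i _ => ?_
  rw [← mul_smul, ← mul_smul, ← pow_succ, ← pow_succ']

omit [Fact (Irreducible (superellipticPoly K L p f))] hp in
/-- `N ∘ (1 - δ) = 0`: `∑_{i<p} δ^i (x - δ x) = 0`. [folklore] -/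
theorem sum_deck_pow_smul_sub_deck_smul [NeZero p] {β : Type*} [AddCommGroup β] [DistribMulAction (CyclicCoverDeck L p) β]
    {ζ₀ : L} (hζ₀ : IsPrimitiveRoot ζ₀ p) (x : β) :
    ∑ i ∈ Finset.range p, (CyclicCoverDeck.ofRoot hζ₀.pow_eq_one ^ i) • (x - CyclicCoverDeck.ofRoot hζ₀.pow_eq_one • x) = 0 := by
  simp only [smul_sub, Finset.sum_sub_distrib, sum_deck_pow_smul_deck_smul hζ₀ x, sub_self]

/-- **The norm of a degree-zero divisor is the divisor of a rational function**: for `deg D = 0`,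
`∑_{i<p} δ^i D = (r)` for some `r ∈ L(x)^×` (`p ∤ deg f`). By the norm relation
(`sum_deck_pow_smul_sub_mem`) `∑ δ^i D = (z)`; the divisor `(z)` is deck-invariant, so `δ z = c z` and
`z = r(x) y^j` (`exists_eq_smul_genY_pow`); comparing coefficients at a ramification place `T_α`
(`p · D(T_α) = p · v_α(r) + j`) gives `j = 0`. [cite: Schaefer1998, §3 (proof of Prop. 3.2)] -/
theorem exists_sum_deck_pow_smul_eq_principalDivisor [IsAlgClosed L] {ζ₀ : L} (hζ₀ : IsPrimitiveRoot ζ₀ p)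
    (hsep : f.Separable) (hndvd : ¬ p ∣ f.natDegree) {D : Divisor L (SuperellipticFunctionField K L p f)}
    (hD : D.degree = 0) :
    ∃ r : RatFunc L, r ≠ 0 ∧
      ∑ i ∈ Finset.range p, (CyclicCoverDeck.ofRoot hζ₀.pow_eq_one ^ i) • D =
        principalDivisor L (algebraMap (RatFunc L) (SuperellipticFunctionField K L p f) r) := by
  haveI : NeZero p := ⟨hp.out.ne_zero⟩
  haveI := isIntegrallyClosedIn_of_isAlgClosed (K := L) (F := SuperellipticFunctionField K L p f)
  have hf : f ≠ 0 := hsep.ne_zero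
  set δ := CyclicCoverDeck.ofRoot hζ₀.pow_eq_one with hδ
  set N : Divisor L (SuperellipticFunctionField K L p f) := ∑ i ∈ Finset.range p, (δ ^ i) • D with hN
  -- `N` is principal
  have hmem : N ∈ principalDivisors L (SuperellipticFunctionField K L p f) := by
    have h := sum_deck_pow_smul_sub_mem hζ₀ hsep hndvd D
    rwa [hD, mul_zero, zero_smul, sub_zero] at h
  obtain ⟨z, hz0, hz⟩ := mem_principalDivisors_iff.1 hmem
  -- `(z)` is `δ`-invariant, so `δ z = c z`
  have hNδ : δ • N = N := deck_smul_sum_deck_pow_smul hζ₀ D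
  have hδz0 : δ • z ≠ 0 := (smul_ne_zero_iff_ne δ).2 hz0
  have hquot : principalDivisor L (δ • z * z⁻¹) = 0 := by
    rw [principalDivisor_mul hδz0 (inv_ne_zero hz0), principalDivisor_inv hz0, ← smul_principalDivisor, hz, hNδ,
      add_neg_cancel]
  obtain ⟨c, -, hc⟩ := exists_eq_algebraMap_of_principalDivisor_eq_zero (mul_ne_zero hδz0 (inv_ne_zero hz0)) hquot
  have hδz : δ • z = algebraMap L _ c * z := by rw [hc, inv_mul_cancel_right₀ hz0]
  obtain ⟨j, r, hj, hzr⟩ := exists_eq_smul_genY_pow hζ₀ hz0 hδz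
  have hr0 : r ≠ 0 := by rintro rfl; rw [zero_smul] at hzr; exact hz0 hzr
  have hy0 : genY K L p f ≠ 0 := genY_ne_zero hp.out.ne_zero hf
  -- a ramification place `T_α`
  obtain ⟨α, hα⟩ : ∃ α, (f.map (algebraMap K L)).IsRoot α := by
    have hnd : f.natDegree ≠ 0 := fun h0 => hndvd (h0 ▸ dvd_zero p)
    refine IsAlgClosed.exists_root _ ?_
    rw [degree_map_eq_of_injective (algebraMap K L).injective, degree_eq_natDegree hf]
    exact_mod_cast hnd
  have hfix : ∀ i : ℕ, (δ ^ i) • rootPlace K L p f α = rootPlace K L p f α := fun i =>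
    deck_smul_rootPlace hsep hα _
  -- `N(T_α) = p · D(T_α)`
  have hNT : N (rootPlace K L p f α) = p * D (rootPlace K L p f α) := by
    rw [hN, Finsupp.finsetSum_apply,
      Finset.sum_congr rfl fun i _ => show ((δ ^ i) • D) (rootPlace K L p f α) = D (rootPlace K L p f α) by
        rw [smul_divisor_apply, inv_smul_eq_iff.2 (hfix i).symm],
      Finset.sum_const, Finset.card_range, nsmul_eq_mul]
  -- `(z)(T_α) = p · v_α(r) + j`
  have hzT : principalDivisor L z (rootPlace K L p f α) = p * (placeXSubC α).ord r + j := by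
    rw [principalDivisor_apply_of_ne_zero hz0, hzr, Algebra.smul_def,
      (rootPlace K L p f α).ord_mul_eq ((_root_.map_ne_zero _).2 hr0) (pow_ne_zero _ hy0),
      (rootPlace K L p f α).ord_pow hy0, ord_rootPlace_genY hsep hα, ord_algebraMap_ratFunc,
      ramificationIdx_rootPlace hsep hα, restrict_rootPlace, mul_one]
  -- hence `p ∣ j`, `j = 0`
  have hj0 : j = 0 := by
    have h1 : N (rootPlace K L p f α) = principalDivisor L z (rootPlace K L p f α) := by rw [hz]
    rw [hNT, hzT] at h1
    have hdvd : (p : ℤ) ∣ (j : ℤ) := ⟨D (rootPlace K L p f α) - (placeXSubC α).ord r, by linarith⟩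
    exact Nat.eq_zero_of_dvd_of_lt (Int.natCast_dvd_natCast.1 hdvd) hj
  refine ⟨r, hr0, ?_⟩
  rw [← hz, hzr, hj0, pow_zero, Algebra.smul_def, mul_one]

/-! ### Orbits of places under the deck group: `ker N = im (1 - δ)` on divisors -/

omit [Fact (Irreducible (superellipticPoly K L p f))] hp in
/-- An element fixed by the deck transformation of a primitive root is fixed by the whole deck group.
[folklore] -/
theorem forall_deck_smul_eq_of_ofRoot_smul_eq [NeZero p] {β : Type*} [MulAction (CyclicCoverDeck L p) β]
    {ζ₀ : L} (hζ₀ : IsPrimitiveRoot ζ₀ p) {x : β} (hx : CyclicCoverDeck.ofRoot hζ₀.pow_eq_one • x = x) :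
    ∀ ζ : CyclicCoverDeck L p, ζ • x = x := by
  intro ζ
  obtain ⟨j, -, rfl⟩ := CyclicCoverDeck.exists_eq_ofRoot_pow hζ₀ ζ
  induction j with
  | zero => rw [pow_zero, one_smul]
  | succ j ih => rw [pow_succ, mul_smul, hx, ih]

omit [Fact (Irreducible (superellipticPoly K L p f))] in
/-- If `δ^m x = x` with `p ∤ m` then `δ x = x` (`δ^m` is again the deck transformation of a primitive
`p`-th root of unity). [folklore] -/
theorem deck_smul_eq_of_pow_smul_eq {β : Type*} [MulAction (CyclicCoverDeck L p) β]
    {ζ₀ : L} (hζ₀ : IsPrimitiveRoot ζ₀ p) {x : β} {m : ℕ} (hm : ¬ p ∣ m)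
    (hx : (CyclicCoverDeck.ofRoot hζ₀.pow_eq_one ^ m) • x = x) :
    CyclicCoverDeck.ofRoot hζ₀.pow_eq_one • x = x := by
  haveI : NeZero p := ⟨hp.out.ne_zero⟩
  have hζ₁ : IsPrimitiveRoot (ζ₀ ^ m) p := hζ₀.pow_of_coprime m ((hp.out.coprime_iff_not_dvd.2 hm).symm)
  have heq : CyclicCoverDeck.ofRoot hζ₁.pow_eq_one = CyclicCoverDeck.ofRoot hζ₀.pow_eq_one ^ m :=
    CyclicCoverDeck.val_injective (by
      rw [CyclicCoverDeck.val_ofRoot, CyclicCoverDeck.val_pow_eq_pow_val, CyclicCoverDeck.val_ofRoot])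
  have hx' : CyclicCoverDeck.ofRoot hζ₁.pow_eq_one • x = x := by rw [heq, hx]
  exact forall_deck_smul_eq_of_ofRoot_smul_eq hζ₁ hx' _

omit [Fact (Irreducible (superellipticPoly K L p f))] in
/-- **Orbits of the deck group have `1` or `p` elements**: either `δ x = x`, or the `δ^i x`, `i < p`, are
pairwise distinct. [folklore] -/
theorem deck_smul_eq_or_pow_smul_injective {β : Type*} [MulAction (CyclicCoverDeck L p) β]
    {ζ₀ : L} (hζ₀ : IsPrimitiveRoot ζ₀ p) (x : β) :
    CyclicCoverDeck.ofRoot hζ₀.pow_eq_one • x = x ∨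
      ∀ i j, i < p → j < p → (CyclicCoverDeck.ofRoot hζ₀.pow_eq_one ^ i) • x =
        (CyclicCoverDeck.ofRoot hζ₀.pow_eq_one ^ j) • x → i = j := by
  haveI : NeZero p := ⟨hp.out.ne_zero⟩
  set δ := CyclicCoverDeck.ofRoot hζ₀.pow_eq_one with hδ
  have hδp : δ ^ p = 1 := CyclicCoverDeck.ofRoot_pow_eq_one hζ₀.pow_eq_one
  by_cases hfix : δ • x = x
  · exact Or.inl hfix
  refine Or.inr fun i j hi hj h => ?_
  by_contra hij
  -- `δ^(p - j + i) x = x`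
  have hm : (δ ^ (p - j + i)) • x = x := by
    have h1 : (δ ^ (p - j)) • (δ ^ i) • x = (δ ^ (p - j)) • (δ ^ j) • x := by rw [h]
    rwa [← mul_smul, ← mul_smul, ← pow_add, ← pow_add, Nat.sub_add_cancel hj.le, hδp, one_smul] at h1
  have hndvd : ¬ p ∣ (p - j + i) := by
    rintro ⟨k, hk⟩
    rcases k with _ | _ | k
    · omega
    · omega
    · have : p * 2 ≤ p * (k + 1 + 1) := Nat.mul_le_mul_left p (by omega)
      omega
  exact hfix (deck_smul_eq_of_pow_smul_eq hζ₀ hndvd hm)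

/-- **Coefficients of the norm**: `(∑_{i<p} δ^i E)(Q) = ∑_{i<p} E(δ^i Q)` (reindex `i ↦ -i mod p`). [folklore] -/
theorem sum_deck_pow_smul_apply {ζ₀ : L} (hζ₀ : IsPrimitiveRoot ζ₀ p)
    (E : Divisor L (SuperellipticFunctionField K L p f)) (Q : PlaceOver L (SuperellipticFunctionField K L p f)) :
    (∑ i ∈ Finset.range p, (CyclicCoverDeck.ofRoot hζ₀.pow_eq_one ^ i) • E) Q =
      ∑ i ∈ Finset.range p, E ((CyclicCoverDeck.ofRoot hζ₀.pow_eq_one ^ i) • Q) := by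
  haveI : NeZero p := ⟨hp.out.ne_zero⟩
  set δ := CyclicCoverDeck.ofRoot hζ₀.pow_eq_one with hδ
  have hδp : δ ^ p = 1 := CyclicCoverDeck.ofRoot_pow_eq_one hζ₀.pow_eq_one
  rw [Finsupp.finsetSum_apply]
  simp only [smul_divisor_apply]
  rw [← Fin.sum_univ_eq_sum_range (fun i => E ((δ ^ i)⁻¹ • Q)) p,
    ← Fin.sum_univ_eq_sum_range (fun i => E ((δ ^ i) • Q)) p]
  refine Fintype.sum_equiv (Equiv.neg (Fin p)) _ _ fun i => ?_
  -- `(δ^i)⁻¹ = δ^(-i mod p)`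
  have hmod : (((-i : Fin p) : ℕ) + (i : ℕ)) % p = 0 := by
    rw [← Fin.val_add (-i) i, neg_add_cancel, Fin.val_zero]
  obtain ⟨k, hk⟩ := Nat.dvd_of_mod_eq_zero hmod
  have hone : δ ^ ((-i : Fin p) : ℕ) * δ ^ (i : ℕ) = 1 := by
    rw [← pow_add, hk, pow_mul, hδp, one_pow]
  have hinv : (δ ^ (i : ℕ))⁻¹ = δ ^ ((-i : Fin p) : ℕ) := (eq_inv_of_mul_eq_one_left hone).symm
  change E ((δ ^ (i : ℕ))⁻¹ • Q) = E ((δ ^ ((Equiv.neg (Fin p) i : Fin p) : ℕ)) • Q)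
  rw [hinv]
  rfl

/-- Coefficients of a sum supported on a free orbit, on the orbit. [folklore] -/
theorem orbitSum_apply_pow_smul {ζ₀ : L} (hζ₀ : IsPrimitiveRoot ζ₀ p)
    {Q : PlaceOver L (SuperellipticFunctionField K L p f)}
    (hinj : ∀ i j, i < p → j < p → (CyclicCoverDeck.ofRoot hζ₀.pow_eq_one ^ i) • Q =
      (CyclicCoverDeck.ofRoot hζ₀.pow_eq_one ^ j) • Q → i = j)
    (g : ℕ → ℤ) {m : ℕ} (hm : m < p) :
    (∑ i ∈ Finset.range p, Finsupp.single ((CyclicCoverDeck.ofRoot hζ₀.pow_eq_one ^ i) • Q) (g i) :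
        Divisor L (SuperellipticFunctionField K L p f)) ((CyclicCoverDeck.ofRoot hζ₀.pow_eq_one ^ m) • Q) = g m := by
  rw [Finsupp.finsetSum_apply, Finset.sum_eq_single m]
  · exact Finsupp.single_eq_same
  · intro i hi him
    rw [Finsupp.single_apply, if_neg]
    exact fun h => him (hinj i m (Finset.mem_range.1 hi) hm h)
  · intro h; exact absurd (Finset.mem_range.2 hm) h

/-- Coefficients of a sum supported on an orbit, off the orbit. [folklore] -/
theorem orbitSum_apply_of_forall_ne {ζ₀ : L} (hζ₀ : IsPrimitiveRoot ζ₀ p)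
    {Q Q' : PlaceOver L (SuperellipticFunctionField K L p f)}
    (hQ' : ∀ m, m < p → Q' ≠ (CyclicCoverDeck.ofRoot hζ₀.pow_eq_one ^ m) • Q) (g : ℕ → ℤ) :
    (∑ i ∈ Finset.range p, Finsupp.single ((CyclicCoverDeck.ofRoot hζ₀.pow_eq_one ^ i) • Q) (g i) :
        Divisor L (SuperellipticFunctionField K L p f)) Q' = 0 := by
  rw [Finsupp.finsetSum_apply]
  refine Finset.sum_eq_zero fun i hi => ?_
  rw [Finsupp.single_apply, if_neg]
  exact fun h => hQ' i (Finset.mem_range.1 hi) h.symm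

/-- **Telescoping on one orbit**: with `c_i = ∑_{k ≤ i} a_k` and `∑_{k<p} a_k = 0`,
`E₂ = ∑_{i<p} c_i (δ^i Q)` satisfies `E₂ - δ E₂ = ∑_{i<p} a_i (δ^i Q)`. [folklore] -/
theorem orbitSum_sub_deck_smul_orbitSum {ζ₀ : L} (hζ₀ : IsPrimitiveRoot ζ₀ p)
    (Q : PlaceOver L (SuperellipticFunctionField K L p f)) (a : ℕ → ℤ) (ha : ∑ k ∈ Finset.range p, a k = 0) :
    ((∑ i ∈ Finset.range p, Finsupp.single ((CyclicCoverDeck.ofRoot hζ₀.pow_eq_one ^ i) • Q)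
        (∑ k ∈ Finset.range (i + 1), a k) : Divisor L (SuperellipticFunctionField K L p f)) -
      CyclicCoverDeck.ofRoot hζ₀.pow_eq_one •
        ∑ i ∈ Finset.range p, Finsupp.single ((CyclicCoverDeck.ofRoot hζ₀.pow_eq_one ^ i) • Q)
          (∑ k ∈ Finset.range (i + 1), a k)) =
      ∑ i ∈ Finset.range p, Finsupp.single ((CyclicCoverDeck.ofRoot hζ₀.pow_eq_one ^ i) • Q) (a i) := by
  haveI : NeZero p := ⟨hp.out.ne_zero⟩
  set δ := CyclicCoverDeck.ofRoot hζ₀.pow_eq_one with hδ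
  have hδp : δ ^ p = 1 := CyclicCoverDeck.ofRoot_pow_eq_one hζ₀.pow_eq_one
  set c : ℕ → ℤ := fun i => ∑ k ∈ Finset.range (i + 1), a k with hc
  have hc0 : c 0 = a 0 := by simp [hc]
  have hcs : ∀ i, c (i + 1) = c i + a (i + 1) := fun i => by
    simp only [hc]; rw [Finset.sum_range_succ]
  obtain ⟨n, hn⟩ : ∃ n, p = n + 1 := ⟨p - 1, (Nat.succ_pred_eq_of_pos hp.out.pos).symm⟩
  have hcn : c n = 0 := by
    change ∑ k ∈ Finset.range (n + 1), a k = 0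
    rw [← hn, ha]
  -- the single terms
  set S : ℕ → ℤ → Divisor L (SuperellipticFunctionField K L p f) := fun i k => Finsupp.single ((δ ^ i) • Q) k with hS
  have hSδ : ∀ i k, δ • S i k = S (i + 1) k := fun i k => by
    simp only [hS]; rw [Finsupp.comapSMul_single, ← mul_smul, ← pow_succ']
  have hSsub : ∀ i k k', S i k - S i k' = S i (k - k') := fun i k k' => by
    simp only [hS]; rw [Finsupp.single_sub]
  have hSn : ∀ k, S (n + 1) k = S 0 k := fun k => by simp only [hS]; rw [← hn, hδp, pow_zero]
  have hS0 : ∀ i, S i 0 = 0 := fun i => by simp only [hS]; rw [Finsupp.single_zero]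
  have hrange : Finset.range p = Finset.range (n + 1) := by rw [hn]
  change (∑ i ∈ Finset.range p, S i (c i)) - δ • ∑ i ∈ Finset.range p, S i (c i) = ∑ i ∈ Finset.range p, S i (a i)
  rw [Finset.smul_sum, Finset.sum_congr rfl fun i _ => hSδ i (c i), hrange, Finset.sum_range_succ' (fun i => S i (c i)),
    Finset.sum_range_succ (fun i => S (i + 1) (c i)), Finset.sum_range_succ' (fun i => S i (a i)), hSn,
    hc0, hcn, hS0, add_zero]
  rw [show (∑ i ∈ Finset.range n, S (i + 1) (c (i + 1))) + S 0 (a 0) - ∑ i ∈ Finset.range n, S (i + 1) (c i) =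
      (∑ i ∈ Finset.range n, (S (i + 1) (c (i + 1)) - S (i + 1) (c i))) + S 0 (a 0) by
    rw [Finset.sum_sub_distrib]; abel]
  congr 1
  refine Finset.sum_congr rfl fun i _ => ?_
  rw [hSsub, hcs, add_sub_cancel_left]

/-- **`ker N ⊆ (1 - δ) Div`**: a divisor `E` with `∑_{i<p} δ^i E = 0` is of the form `E₂ - δ E₂` — the
vanishing of `Ĥ⁻¹(⟨δ⟩, Div)`: the coefficient of `N(E)` at a deck-fixed place `Q` is `p · E(Q)`, so `E` is
supported on free orbits, and on a free orbit `∑ a_i (δ^i Q)` with `∑ a_i = 0` telescopes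
(`orbitSum_sub_deck_smul_orbitSum`). Induction on the support. [folklore] -/
theorem exists_eq_sub_deck_smul_of_sum_deck_pow_smul_eq_zero {ζ₀ : L} (hζ₀ : IsPrimitiveRoot ζ₀ p) :
    ∀ (n : ℕ) (E : Divisor L (SuperellipticFunctionField K L p f)), E.support.card ≤ n →
      ∑ i ∈ Finset.range p, (CyclicCoverDeck.ofRoot hζ₀.pow_eq_one ^ i) • E = 0 →
        ∃ E₂ : Divisor L (SuperellipticFunctionField K L p f), E = E₂ - CyclicCoverDeck.ofRoot hζ₀.pow_eq_one • E₂ := by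
  haveI : NeZero p := ⟨hp.out.ne_zero⟩
  set δ := CyclicCoverDeck.ofRoot hζ₀.pow_eq_one with hδ
  intro n
  induction n with
  | zero =>
    intro E hE _
    refine ⟨0, ?_⟩
    rw [smul_zero, sub_zero]
    exact Finsupp.support_eq_empty.1 (Finset.card_eq_zero.1 (Nat.le_zero.1 hE))
  | succ n ih =>
    intro E hcard hN
    by_cases hle : E.support.card ≤ n
    · exact ih E hle hN
    have hpos : 0 < E.support.card := by omega
    obtain ⟨Q, hQ⟩ := Finset.card_pos.1 hpos
    have hEQ : E Q ≠ 0 := Finsupp.mem_support_iff.1 hQ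
    -- the coefficients along the orbit of `Q` sum to zero
    have hsum : ∑ i ∈ Finset.range p, E ((δ ^ i) • Q) = 0 := by
      rw [← sum_deck_pow_smul_apply hζ₀ E Q, hN, Finsupp.zero_apply]
    rcases deck_smul_eq_or_pow_smul_injective hζ₀ Q with hfix | hinj
    · -- a fixed place cannot lie in the support
      exfalso
      have hfix' : ∀ i : ℕ, (δ ^ i) • Q = Q := fun i =>
        forall_deck_smul_eq_of_ofRoot_smul_eq hζ₀ hfix _
      rw [Finset.sum_congr rfl fun i _ => show E ((δ ^ i) • Q) = E Q by rw [hfix' i], Finset.sum_const,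
        Finset.card_range, nsmul_eq_mul, mul_eq_zero] at hsum
      rcases hsum with h | h
      · exact hp.out.ne_zero (by exact_mod_cast h)
      · exact hEQ h
    · -- free orbit: subtract its contribution
      set a : ℕ → ℤ := fun i => E ((δ ^ i) • Q) with ha
      set Eorb : Divisor L (SuperellipticFunctionField K L p f) :=
        ∑ i ∈ Finset.range p, Finsupp.single ((δ ^ i) • Q) (a i) with hEorb
      set E₂ : Divisor L (SuperellipticFunctionField K L p f) :=
        ∑ i ∈ Finset.range p, Finsupp.single ((δ ^ i) • Q) (∑ k ∈ Finset.range (i + 1), a k) with hE₂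
      have hB1 : E₂ - δ • E₂ = Eorb := orbitSum_sub_deck_smul_orbitSum hζ₀ Q a hsum
      set E' := E - Eorb with hE'
      -- `N(E') = 0`
      have hN' : ∑ i ∈ Finset.range p, (δ ^ i) • E' = 0 := by
        rw [hE', ← hB1]
        simp only [smul_sub, Finset.sum_sub_distrib]
        rw [hN, sum_deck_pow_smul_deck_smul hζ₀ E₂, sub_self, sub_zero]
      -- the support of `E'` is that of `E` minus the orbit of `Q`
      have hsupp : E'.support ⊆ E.support.erase Q := by
        intro Q' hQ'
        have hE'Q' : E' Q' ≠ 0 := Finsupp.mem_support_iff.1 hQ'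
        have hnot : ∀ m, m < p → Q' ≠ (δ ^ m) • Q := by
          rintro m hm rfl
          apply hE'Q'
          rw [hE', Finsupp.sub_apply, hEorb, orbitSum_apply_pow_smul hζ₀ hinj a hm, sub_self]
        have hval : E' Q' = E Q' := by
          rw [hE', Finsupp.sub_apply, hEorb, orbitSum_apply_of_forall_ne hζ₀ hnot a, sub_zero]
        refine Finset.mem_erase.2 ⟨?_, Finsupp.mem_support_iff.2 (hval ▸ hE'Q')⟩
        intro h
        exact hnot 0 hp.out.pos (by rw [pow_zero, one_smul]; exact h)
      have hcard' : E'.support.card ≤ n := by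
        have h1 := Finset.card_le_card hsupp
        rw [Finset.card_erase_of_mem hQ] at h1
        omega
      obtain ⟨E₃, hE₃⟩ := ih E' hcard' hN'
      refine ⟨E₃ + E₂, ?_⟩
      rw [smul_add, add_sub_add_comm, ← hE₃, hB1, hE', sub_add_cancel]

/-! ### `(1 - δ)`-divisibility of `Pic⁰(C_{f,L})` -/

/-- **`Pic⁰(C_{f,L})` is `(1 - δ)`-divisible** for `L` algebraically closed, `C_f : y^p = f(x)`, `f` separable,
`p ∤ deg f` (`p ≠ char L`): every degree-zero class `c` is `c' - δ c'` with `deg c' = 0` — the vanishing of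
`Ĥ⁻¹(⟨δ⟩, Pic⁰) = Pic⁰ / (1 - δ) Pic⁰` (`N = 1 + δ + ⋯ + δ^{p-1} = 0` on `Pic⁰`), from
`Ĥ⁰(⟨δ⟩, L(C_f)^×) = L(x)^× / N L(C_f)^× = 0` (TSEN: `L(x)` is `(C₁)`) and `Ĥ⁻¹(⟨δ⟩, Div) = 0` (free orbits):
for `deg D = 0`, `∑ δ^i D = (r)` with `r ∈ L(x)` (`exists_sum_deck_pow_smul_eq_principalDivisor`), `r = N(ψ)`
(`exists_prod_deck_pow_smul_eq_algebraMap`), so `∑ δ^i (D - (ψ)) = 0` and `D - (ψ) = E₂ - δ E₂`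
(`exists_eq_sub_deck_smul_of_sum_deck_pow_smul_eq_zero`); finally `deg` is corrected with the fixed place `∞_C`.
This is the function-field substance of "`1 - ζ : J → J` is an isogeny, hence surjective on `L`-points"
(Mumford, *Abelian Varieties* §6, Appl. 2; Schaefer 1998 §3), obtained here without the Jacobian.
[cite: Schaefer1998, §3] [cite: Shatz1972, Ch. IV §3 Thm. 24 (Tsen) and Prop. 33 (2)] -/
theorem exists_sub_deck_smul_eq_of_degree_eq_zero [IsAlgClosed L] {ζ₀ : L} (hζ₀ : IsPrimitiveRoot ζ₀ p)
    (hsep : f.Separable) (hndvd : ¬ p ∣ f.natDegree) {c : SuperellipticPic K L p f}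
    (hc : SuperellipticPic.degree K L p f c = 0) :
    ∃ c' : SuperellipticPic K L p f, SuperellipticPic.degree K L p f c' = 0 ∧
      c' - CyclicCoverDeck.ofRoot hζ₀.pow_eq_one • c' = c := by
  haveI : NeZero p := ⟨hp.out.ne_zero⟩
  have hf : f ≠ 0 := hsep.ne_zero
  set δ := CyclicCoverDeck.ofRoot hζ₀.pow_eq_one with hδ
  obtain ⟨D, rfl⟩ := picMk_surjective (K := K) (L := L) (p := p) (f := f) c
  rw [degree_picMk] at hc
  -- `N(D) = (r)`, `r = N(ψ)`
  obtain ⟨r, hr0, hND⟩ := exists_sum_deck_pow_smul_eq_principalDivisor hζ₀ hsep hndvd hc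
  obtain ⟨ψ, hψ⟩ := exists_prod_deck_pow_smul_eq_algebraMap (K := K) (f := f) hζ₀ hf r
  have hr0' : algebraMap (RatFunc L) (SuperellipticFunctionField K L p f) r ≠ 0 := (_root_.map_ne_zero _).2 hr0
  have hψ0 : ψ ≠ 0 := by
    rintro rfl
    rw [Finset.prod_eq_zero (Finset.mem_range.2 hp.out.pos) (by rw [smul_zero])] at hψ
    exact hr0' hψ.symm
  -- `N(D - (ψ)) = 0`
  have hNψ : ∑ i ∈ Finset.range p, (δ ^ i) • principalDivisor L ψ =
      principalDivisor L (algebraMap (RatFunc L) (SuperellipticFunctionField K L p f) r) := by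
    rw [← hψ, principalDivisor_prod _ _ fun i _ => (smul_ne_zero_iff_ne _).2 hψ0]
    exact Finset.sum_congr rfl fun i _ => smul_principalDivisor _ _
  have hN0 : ∑ i ∈ Finset.range p, (δ ^ i) • (D - principalDivisor L ψ) = 0 := by
    simp only [smul_sub, Finset.sum_sub_distrib]
    rw [hND, hNψ, sub_self]
  obtain ⟨E₂, hE₂⟩ := exists_eq_sub_deck_smul_of_sum_deck_pow_smul_eq_zero hζ₀ _ (D - principalDivisor L ψ) le_rfl hN0
  -- correct the degree with the deck-fixed place `∞_C`
  set E₂' : Divisor L (SuperellipticFunctionField K L p f) :=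
    E₂ - E₂.degree • Finsupp.single (inftyPlace K L p f) 1 with hE₂'
  have hdeg' : E₂'.degree = 0 := by
    rw [hE₂', map_sub, map_zsmul, Divisor.degree_single, degree_inftyPlace hndvd, Nat.cast_one, mul_one,
      smul_eq_mul, mul_one, sub_self]
  have hfixinf : δ • (Finsupp.single (inftyPlace K L p f) (1 : ℤ) : Divisor L (SuperellipticFunctionField K L p f)) =
      Finsupp.single (inftyPlace K L p f) 1 := by
    rw [Finsupp.comapSMul_single, deck_smul_inftyPlace hndvd]
  have hE₂'eq : E₂' - δ • E₂' = E₂ - δ • E₂ := by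
    rw [hE₂', smul_sub, smul_comm δ (Divisor.degree E₂), hfixinf]
    abel
  refine ⟨picMk K L p f E₂', by rw [degree_picMk, hdeg'], ?_⟩
  rw [deck_smul_picMk, ← map_sub, hE₂'eq, ← hE₂, map_sub, sub_eq_self, picMk_eq_zero_iff]
  exact principalDivisor_mem hψ0

end SuperellipticFunctionField

/-! ### `p = 3`: `Pic⁰(C_{f,K̄})` is `3`-divisible for `y³ = f(x)`, `3 ∤ deg f` -/

section Three

open Literature.NumberTheory.EllipticCurves SuperellipticFunctionField

variable {K : Type u} [Field K] {f : K[X]} [Fact (Irreducible (superellipticPoly K (AlgebraicClosure K) 3 f))] {ζ : K}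

/-- **`Pic⁰(C_{f,K̄})` is `λ`-divisible**, `λ = 1 - δ`, for `C_f : y³ = f(x)` over a field `K ∋ ζ₃`, `f` separable,
`3 ∤ deg f`: every degree-zero class is `λ c'` with `deg c' = 0` (`exists_sub_deck_smul_eq_of_degree_eq_zero` over `K̄`).
[cite: Schaefer1998, §3] [cite: Shatz1972, Ch. IV §3 Thm. 24 (Tsen)] -/
theorem geomPic_exists_lamAddMonoidHom_eq (hζ : IsPrimitiveRoot ζ 3) (hsep : f.Separable) (hndvd : ¬ 3 ∣ f.natDegree)
    {c : GeomPic K 3 f} (hc : SuperellipticPic.degree K (AlgebraicClosure K) 3 f c = 0) :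
    ∃ c' : GeomPic K 3 f, SuperellipticPic.degree K (AlgebraicClosure K) 3 f c' = 0 ∧ c' - deckGen hζ • c' = c := by
  haveI : Fact (Nat.Prime 3) := ⟨Nat.prime_three⟩
  exact exists_sub_deck_smul_eq_of_degree_eq_zero (isPrimitiveRoot_algebraMap_algebraicClosure hζ) hsep hndvd hc

/-- **`Pic⁰(C_{f,K̄})` is `3`-divisible** for `C_f : y³ = f(x)` over `K ∋ ζ₃` (`f` separable, `3 ∤ deg f`, so
`char K ≠ 3`): every degree-zero divisor class is `3 c'` with `deg c' = 0` — `3 = -ω² λ²` in `ℤ[ω] = ℤ[δ]`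
(`lamAddMonoidHom_lamAddMonoidHom_of_degree_eq_zero`) and `Pic⁰` is `λ`-divisible (Tsen). This is the case
`N = 3` of the divisibility of `Cl⁰(F/M)` over an algebraically closed constant field (Rosen Thm. 11.12 (i) =
Weil; Mumford §6 Appl. 2) for the function fields `K̄(C_f)`, proved here without the Jacobian — the hypothesis
`hX1'` / `hdiv` of `PicardLambdaAdicRepDivisible`. [cite: RosenFunctionFields2002, Ch. 11, Thm. 11.12]
[cite: Schaefer1998, §3] [cite: Shatz1972, Ch. IV §3 Thm. 24 (Tsen)] -/
theorem geomPic_exists_three_smul_eq_of_degree_eq_zero (hζ : IsPrimitiveRoot ζ 3) (hsep : f.Separable)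
    (hndvd : ¬ 3 ∣ f.natDegree) {c : GeomPic K 3 f} (hc : SuperellipticPic.degree K (AlgebraicClosure K) 3 f c = 0) :
    ∃ c' : GeomPic K 3 f, SuperellipticPic.degree K (AlgebraicClosure K) 3 f c' = 0 ∧ 3 • c' = c := by
  obtain ⟨c₁, hc₁, rfl⟩ := geomPic_exists_lamAddMonoidHom_eq hζ hsep hndvd hc
  obtain ⟨c₂, hc₂, rfl⟩ := geomPic_exists_lamAddMonoidHom_eq hζ hsep hndvd hc₁
  refine ⟨-(deckGen hζ • c₂), by rw [map_neg, geomPic_degree_deck_smul, hc₂, neg_zero], ?_⟩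
  have h := lamAddMonoidHom_lamAddMonoidHom_of_degree_eq_zero hζ hsep hndvd hc₂
  rw [lamAddMonoidHom_apply, lamAddMonoidHom_apply] at h
  rw [h, smul_neg]

/-! ### An injectivity criterion on `3`-power torsion (for reduction maps)

For a homomorphism out of `Pic(C_{f,K̄})` compatible with the deck transformation — such as the reduction map
of the divisor class group at a place of good reduction — injectivity on ALL of the `3`-power torsion is a formal
consequence of injectivity on the `(1 - ω)`-torsion `J[λ] ≅ (𝔽₃^{roots f})⁰` (where it is explicit): the torsion
clause of the Serre–Tate good-reduction datum, for `ℓ = p = 3`, costs nothing beyond the existence of the map. -/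

/-- **Injectivity on `Pic[3]` from injectivity on `J[λ]`**: if `Φ : Pic(C_{f,K̄}) →+ A` intertwines `δ` with some
endomorphism `δ'` of `A` and is injective on `J[λ] = Pic[3] ∩ ker λ`, then it is injective on `Pic[3]`
(`λ c ∈ J[λ]` and `Φ(λ c) = (1 - δ') Φ c`). [folklore] -/
theorem geomPic_eq_zero_of_three_smul_eq_zero (hζ : IsPrimitiveRoot ζ 3) (hsep : f.Separable) (hndvd : ¬ 3 ∣ f.natDegree)
    {A : Type*} [AddCommGroup A] (Φ : GeomPic K 3 f →+ A) (δ' : A →+ A)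
    (hΦ : ∀ c : GeomPic K 3 f, Φ (deckGen hζ • c) = δ' (Φ c))
    (hinj : ∀ c ∈ geomLambdaTorsion K 3 f, Φ c = 0 → c = 0)
    {c : GeomPic K 3 f} (h3 : (3 • c : GeomPic K 3 f) = 0) (hc : Φ c = 0) : c = 0 := by
  have htors : c ∈ AddSubgroup.torsionBy (GeomPic K 3 f) (3 : ℕ) := AddSubgroup.torsionBy.nsmul_iff.2 h3
  have hll := ((geomPic_three_smul_eq_zero_iff hζ hsep hndvd c).1 h3).2
  -- `λ c ∈ J[λ]` and `Φ (λ c) = 0`, so `λ c = 0`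
  have hlam_mem : lamAddMonoidHom hζ c ∈ geomLambdaTorsion K 3 f := by
    rw [mem_geomLambdaTorsion_iff hζ hsep hndvd]
    refine ⟨AddSubgroup.torsionBy.nsmul_iff.2 ?_, hll⟩
    rw [← map_nsmul, h3, map_zero]
  have hΦlam : Φ (lamAddMonoidHom hζ c) = 0 := by
    rw [lamAddMonoidHom_apply, map_sub, hΦ, hc, map_zero, sub_zero]
  have hlam0 : lamAddMonoidHom hζ c = 0 := hinj _ hlam_mem hΦlam
  -- hence `c ∈ J[λ]`, `Φ c = 0`, `c = 0`
  exact hinj c ((mem_geomLambdaTorsion_iff hζ hsep hndvd c).2 ⟨htors, hlam0⟩) hc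

/-- **Injectivity on all `3`-power torsion from injectivity on `J[λ]`** (induction on `n`: if `3ⁿ⁺¹ c = 0` and
`Φ c = 0` then `3 c` is killed by `3ⁿ` and by `Φ`). For the reduction map `red` of `Pic(C_{f,K̄})` at a place of
good reduction (deck-compatible, sending `[T_α - ∞]` to `[T_ᾱ - ∞̄]`, hence injective on `J[λ]`) this is the
torsion clause of the good-reduction datum (Serre–Tate 1968 §1 Lemma 2) for `ℓ = 3`, obtained formally.
[cite: SerreTate1968GoodReduction, §1, Lemma 2] -/
theorem geomPic_eq_zero_of_three_pow_smul_eq_zero (hζ : IsPrimitiveRoot ζ 3) (hsep : f.Separable)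
    (hndvd : ¬ 3 ∣ f.natDegree) {A : Type*} [AddCommGroup A] (Φ : GeomPic K 3 f →+ A) (δ' : A →+ A)
    (hΦ : ∀ c : GeomPic K 3 f, Φ (deckGen hζ • c) = δ' (Φ c))
    (hinj : ∀ c ∈ geomLambdaTorsion K 3 f, Φ c = 0 → c = 0) :
    ∀ (n : ℕ) {c : GeomPic K 3 f}, (3 ^ n • c : GeomPic K 3 f) = 0 → Φ c = 0 → c = 0 := by
  intro n
  induction n with
  | zero => intro c h _; rwa [pow_zero, one_smul] at h
  | succ n ih =>
    intro c h hc
    have h3c : (3 ^ n • (3 • c) : GeomPic K 3 f) = 0 := by rwa [smul_smul, ← pow_succ]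
    have hΦ3 : Φ (3 • c) = 0 := by rw [map_nsmul, hc, smul_zero]
    exact geomPic_eq_zero_of_three_smul_eq_zero hζ hsep hndvd Φ δ' hΦ hinj (ih h3c hΦ3) hc

end Three

/-! ### The Picard curve: `#J_f[3ⁿ] = 3^{6n}`, `T₃ J_f ≅ ℤ₃⁶ ≅ ℤ₃[ω]³`, unconditionally -/

section Picard

open Literature.NumberTheory.EllipticCurves SuperellipticFunctionField

variable (K : Type) [Field K] [CharZero K] [IsCyclotomicExtension {3} ℚ K]

/-- **`#J_f[3ⁿ] = 3^{6n}` for the Picard curve `y³ = f(x)`** (`f ∈ ℤ[X]` a quartic separable over `ℚ`, `J_f[3ⁿ]` the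
`3ⁿ`-torsion of `Pic(C_{f,K̄})`, `K ⊇ ℚ(ω)`), UNCONDITIONALLY: `picard_hcard_of_divisible` with the `3`-divisibility of
`Pic⁰(C_{f,K̄})` now proved (`geomPic_exists_three_smul_eq_of_degree_eq_zero`). This is `#J[ℓⁿ] = ℓ^{2gn}` (`g = 3`,
`ℓ = 3`) for these curves (Rosen, Cor. to Thm. 11.12; Mumford §6), the rank input of Upton's `λ`-adic representations.
[cite: Upton2009, §2] [cite: RosenFunctionFields2002, Ch. 11, Thm. 11.12] -/
theorem picard_card_torsionBy_three_pow (f : ℤ[X]) (h4 : f.natDegree = 4) (hsep : (f.map (Int.castRingHom ℚ)).Separable)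
    (n : ℕ) :
    haveI := fact_irreducible_superellipticPoly_picard K h4 hsep
    Nat.card (AddSubgroup.torsionBy (GeomPic K 3 (f.map (algebraMap ℤ K))) (3 ^ n : ℕ)) = 3 ^ (6 * n) := by
  haveI := fact_irreducible_superellipticPoly_picard K h4 hsep
  have h := picard_hcard_of_divisible K f h4 hsep
    (fun c hc => (geomPic_exists_three_smul_eq_of_degree_eq_zero (isPrimitiveRoot_zeta3 K)
      (separable_map_algebraMap_int K hsep) (not_three_dvd_natDegree_map K h4) hc).imp fun _ h => h.2) n
  rw [h]

/-- **`T₃ J(C_f) ≅ ℤ₃⁶`** for the Picard curve, unconditionally: the `3`-adic Tate module of `Pic(C_{f,K̄})` is free of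
rank `6 = 2g` over `ℤ₃` (`TateModule.nonempty_linearEquiv_of_card_torsionBy` with `picard_card_torsionBy_three_pow`).
[cite: Upton2009, §2] [cite: SerreAbelianLadic1968, Ch. I §1.1] -/
theorem picard_nonempty_tateModule_linearEquiv (f : ℤ[X]) (h4 : f.natDegree = 4)
    (hsep : (f.map (Int.castRingHom ℚ)).Separable) :
    haveI := fact_irreducible_superellipticPoly_picard K h4 hsep
    Nonempty (TateModule (GeomPic K 3 (f.map (algebraMap ℤ K))) 3 ≃ₗ[ℤ_[3]] (Fin 6 → ℤ_[3])) := by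
  haveI := fact_irreducible_superellipticPoly_picard K h4 hsep
  exact TateModule.nonempty_linearEquiv_of_card_torsionBy (picard_card_torsionBy_three_pow K f h4 hsep)

/-- **`T₃ J(C_f) ≅ ℤ₃[ω]³`** for the Picard curve, unconditionally: as a module over `ℤ₃[ω]` (`ω ↦ δ = (y ↦ ζ y)`,
`tateModulePadicEisenstein`) the Tate module is free of rank `3` (`picard_nonempty_basis_tateModule` with the torsion
count `picard_card_torsionBy_three_pow`). [cite: Upton2009, §2] [cite: SerreAbelianLadic1968, Ch. I §1.1] -/
theorem picard_nonempty_tateModule_linearEquiv_padicEisenstein (f : ℤ[X]) (h4 : f.natDegree = 4)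
    (hsep : (f.map (Int.castRingHom ℚ)).Separable) {ζ : K} (hζ : IsPrimitiveRoot ζ 3) :
    haveI := fact_irreducible_superellipticPoly_picard K h4 hsep
    letI := tateModulePadicEisenstein (f.map (algebraMap ℤ K)) hζ (separable_map_algebraMap_int K hsep)
      (not_three_dvd_natDegree_map K h4)
    Nonempty ((Fin 3 → PadicEisenstein) ≃ₗ[PadicEisenstein] TateModule (GeomPic K 3 (f.map (algebraMap ℤ K))) 3) := by
  haveI := fact_irreducible_superellipticPoly_picard K h4 hsep
  letI := tateModulePadicEisenstein (f.map (algebraMap ℤ K)) hζ (separable_map_algebraMap_int K hsep)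
    (not_three_dvd_natDegree_map K h4)
  obtain ⟨b⟩ := picard_nonempty_basis_tateModule K f h4 hsep hζ (fun n => by
    rw [picard_card_torsionBy_three_pow K f h4 hsep n])
  exact ⟨b.equivFun.symm⟩

end Picard

end Literature.NumberTheory.GaloisRepresentations
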